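import Literature.Geometry.DiscreteGeometry.KissingSearchRoot
import Summits.Ventures.Crystal3D.Kissing125.GSearchDefs1
import HarnessLib

/-!
# Structures, codes and semantics of the growth search, κ-generic — part 2/3

HONEST FRAMING (cell pub-crystal3d, K-path at `h = 5/4`, V4 = κ as an explicit parameter): this is NOT a result printed
by Hales; it is his METHOD (arXiv:1209.6043, Theorem 3 + Lemmas 7–10, in the tree's form of a verified interval-arithmetic
growth search, `Literature/…/KissingSearch*.lean`) with the largest long-side cosine `κ` made an EXPLICIT PARAMETER
(`κ : Kappa`, carrying the two numeric facts the soundness proof uses: `-1/2 ≤ κ`, `κ < 1/4`).  Only the declarations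
whose statement depends on `κ` are declared here (namespace `…Kissing125.GSearch`, the tree's short names, no renames);
every κ-free helper is the landed K25 copy (`…Kissing125.KissingSearch.*`) and every κ-free lemma is cited from the tree
(PRIVATE per-file citation aliases; `GSearchTransport.lean` holds `toT : St → tree St` and the transport equalities).  The K25
instance is `κ25 = ⟨7/32, …⟩`; `GSearchBridge.lean` identifies the generic checker at
`κ25` with the landed `Kissing125.KissingSearch.checkPart`, so the landed run files are consumed unchanged.  Generated by
`HOME/lean/kissing125/v4-prep/gen/mkgen.py`; nothing here is asserted about GAP(1.26) or any census.

THIS FILE: the κ-tainted declarations of `Literature/Geometry/DiscreteGeometry/KissingSearchDefs.lean` (part 2 of 3), with `κ : Kappa` threaded; κ-free declarations of that file are NOT re-declared publicly (the κ-free helpers are the landed K25 copies; the κ-free tree lemmas used by the proofs are cited through PRIVATE aliases at the top of the file).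

## References
* T. C. Hales, *A proof of Fejes Tóth's conjecture on sphere packings with kissing number twelve*,
  arXiv:1209.6043 (2012): Definition 1, Theorem 2, Theorem 3, Lemmas 7–10. [`Hales2012`]
* R. E. Moore, *Interval Analysis* (1966), Theorem 3.1, §4.4. [`Moore1966`]
-/

namespace Summit.Ventures.Crystal3D.Kissing125

open Literature.Geometry.DiscreteGeometry
open Summit.Ventures.Crystal3D.Kissing125.KissingSearch

namespace GSearch

open Real Literature.Analysis.ValidatedNumerics KissingLP NonemptyInterval Finset

variable {κ : Kappa}

/-! ### κ-free tree lemmas used below, read over the K25 copies (PRIVATE citation aliases; the public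
surface of this file is κ-generic only) -/

/-- K25 reading of the tree lemma `card_relab` (κ-free; proof = citation of the tree lemma). [folklore] -/
private theorem card_relab (σ : Equiv.Perm ℕ) (t : Finset ℕ) : #(relab σ t) = #t :=
  Literature.Geometry.DiscreteGeometry.KissingSearch.card_relab σ t

/-- K25 reading of the tree lemma `symm_lt_iff` (κ-free; proof = citation of the tree lemma). [folklore] -/
private theorem symm_lt_iff (σ : Equiv.Perm ℕ)
  (hσ : ∀ (a : ℕ), (σ : ℕ → ℕ) a < 12 ↔ a < 12) (a : ℕ) : (Equiv.symm σ : ℕ → ℕ) a < 12 ↔ a < 12 :=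
  Literature.Geometry.DiscreteGeometry.KissingSearch.symm_lt_iff σ hσ a


section Relabel
variable (M : KConf κ) (σ : Equiv.Perm ℕ) (hσ : ∀ a, σ a < 12 ↔ a < 12)
include hσ in
/-- **The relabelled structure.** [folklore] -/
def KConf.relabel : KConf κ where
  g := fun a b => M.g (σ.symm a) (σ.symm b)
  T := M.T.image (relab σ)
  ang := fun t v => M.ang (relab σ.symm t) (σ.symm v)
  g_symm := fun a b => M.g_symm _ _
  mem_T := by
    intro t ht
    rw [Finset.mem_image] at ht
    obtain ⟨t₀, ht₀, rfl⟩ := ht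
    obtain ⟨hc, hl⟩ := M.mem_T t₀ ht₀
    refine ⟨by rw [card_relab, hc], fun a ha => ?_⟩
    rw [mem_relab_iff] at ha
    have := hl _ ha
    rwa [symm_lt_iff σ hσ] at this
  card_T := by rw [Finset.card_image_of_injective _ (relab_injective σ), M.card_T]
  two := by
    intro t ht a ha b hb hab
    rw [Finset.mem_image] at ht
    obtain ⟨t₀, ht₀, rfl⟩ := ht
    rw [mem_relab_iff] at ha hb
    have h := M.two t₀ ht₀ _ ha _ hb (fun e => hab (σ.symm.injective e))
    rw [← h]
    -- the filter on the image is the image of the filter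
    have : (M.T.image (relab σ)).filter (fun t' => a ∈ t' ∧ b ∈ t') =
        (M.T.filter fun t' => σ.symm a ∈ t' ∧ σ.symm b ∈ t').image (relab σ) := by
      ext t'
      simp only [Finset.mem_filter, Finset.mem_image]
      constructor
      · rintro ⟨⟨t₁, ht₁, rfl⟩, ha', hb'⟩
        rw [mem_relab_iff] at ha' hb'
        exact ⟨t₁, ⟨ht₁, ha', hb'⟩, rfl⟩
      · rintro ⟨t₁, ⟨ht₁, ha', hb'⟩, rfl⟩
        exact ⟨⟨t₁, ht₁, rfl⟩, (mem_relab_iff σ).2 ha', (mem_relab_iff σ).2 hb'⟩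
    rw [this, Finset.card_image_of_injective _ (relab_injective σ)]
  contact_side := by
    intro a b ha hb hab hg
    obtain ⟨t, ht, hat, hbt⟩ := M.contact_side _ _ ((symm_lt_iff σ hσ a).2 ha) ((symm_lt_iff σ hσ b).2 hb)
      (fun e => hab (σ.symm.injective e)) hg
    exact ⟨relab σ t, Finset.mem_image_of_mem _ ht, (mem_relab_iff σ).2 hat, (mem_relab_iff σ).2 hbt⟩
  dichot := fun a b ha hb hab => M.dichot _ _ ((symm_lt_iff σ hσ a).2 ha) ((symm_lt_iff σ hσ b).2 hb)
    (fun e => hab (σ.symm.injective e))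
  side_bound := by
    intro t ht a ha b hb hab
    rw [Finset.mem_image] at ht
    obtain ⟨t₀, ht₀, rfl⟩ := ht
    rw [mem_relab_iff] at ha hb
    exact M.side_bound t₀ ht₀ _ ha _ hb (fun e => hab (σ.symm.injective e))
  cdeg_le := by
    intro a ha
    have h := M.cdeg_le (σ.symm a) ((symm_lt_iff σ hσ a).2 ha)
    refine le_trans (le_of_eq ?_) h
    refine Finset.card_bij (fun b _ => σ.symm b) ?_ ?_ ?_
    · intro b hb
      simp only [Finset.mem_filter, Finset.mem_range] at hb ⊢
      exact ⟨(symm_lt_iff σ hσ b).2 hb.1, fun e => hb.2.1 (σ.symm.injective e), hb.2.2⟩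
    · intro b _ b' _ e; exact σ.symm.injective e
    · intro c hc
      simp only [Finset.mem_filter, Finset.mem_range] at hc
      refine ⟨σ c, ?_, by simp⟩
      simp only [Finset.mem_filter, Finset.mem_range]
      refine ⟨(hσ c).2 hc.1, fun e => hc.2.1 ?_, by simpa using hc.2.2⟩
      have := congrArg σ.symm e; simpa using this
  contacts_ge := by
    refine le_trans M.contacts_ge (le_of_eq ?_)
    symm
    -- bijection on pairs: (p, q) ↦ sorted (σ⁻¹ p, σ⁻¹ q)
    refine Finset.card_bij (fun p _ => (min (σ.symm p.1) (σ.symm p.2), max (σ.symm p.1) (σ.symm p.2))) ?_ ?_ ?_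
    · intro p hp
      simp only [Finset.mem_filter, Finset.mem_product, Finset.mem_range] at hp ⊢
      obtain ⟨⟨h1, h2⟩, hlt, hg⟩ := hp
      have h1' := (symm_lt_iff σ hσ p.1).2 h1
      have h2' := (symm_lt_iff σ hσ p.2).2 h2
      have hne : σ.symm p.1 ≠ σ.symm p.2 := fun e => (ne_of_lt hlt) (σ.symm.injective e)
      refine ⟨⟨by omega, by omega⟩, by omega, ?_⟩
      rcases le_total (σ.symm p.1) (σ.symm p.2) with h | h
      · rw [min_eq_left h, max_eq_right h]; exact hg
      · rw [min_eq_right h, max_eq_left h, M.g_symm]; exact hg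
    · intro p hp p' hp' e
      simp only [Finset.mem_filter, Finset.mem_product, Finset.mem_range] at hp hp'
      simp only [Prod.mk.injEq] at e
      obtain ⟨e1, e2⟩ := e
      -- {σ⁻¹ p.1, σ⁻¹ p.2} = {σ⁻¹ p'.1, σ⁻¹ p'.2} as unordered pairs, with p.1 < p.2, p'.1 < p'.2
      have key : (σ.symm p.1 = σ.symm p'.1 ∧ σ.symm p.2 = σ.symm p'.2) ∨
          (σ.symm p.1 = σ.symm p'.2 ∧ σ.symm p.2 = σ.symm p'.1) := by
        rcases le_total (σ.symm p.1) (σ.symm p.2) with h | h <;>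
          rcases le_total (σ.symm p'.1) (σ.symm p'.2) with h' | h'
        · rw [min_eq_left h, min_eq_left h'] at e1; rw [max_eq_right h, max_eq_right h'] at e2
          exact Or.inl ⟨e1, e2⟩
        · rw [min_eq_left h, min_eq_right h'] at e1; rw [max_eq_right h, max_eq_left h'] at e2
          exact Or.inr ⟨e1, e2⟩
        · rw [min_eq_right h, min_eq_left h'] at e1; rw [max_eq_left h, max_eq_right h'] at e2
          exact Or.inr ⟨e2, e1⟩
        · rw [min_eq_right h, min_eq_right h'] at e1; rw [max_eq_left h, max_eq_left h'] at e2
          exact Or.inl ⟨e2, e1⟩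
      rcases key with ⟨k1, k2⟩ | ⟨k1, k2⟩
      · exact Prod.ext (σ.symm.injective k1) (σ.symm.injective k2)
      · exfalso
        have a1 := σ.symm.injective k1
        have a2 := σ.symm.injective k2
        have := hp.2.1; have := hp'.2.1
        omega
    · intro q hq
      simp only [Finset.mem_filter, Finset.mem_product, Finset.mem_range] at hq
      obtain ⟨⟨h1, h2⟩, hlt, hg⟩ := hq
      refine ⟨(min (σ q.1) (σ q.2), max (σ q.1) (σ q.2)), ?_, ?_⟩
      · simp only [Finset.mem_filter, Finset.mem_product, Finset.mem_range]
        have h1' := (hσ q.1).2 h1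
        have h2' := (hσ q.2).2 h2
        have hne : σ q.1 ≠ σ q.2 := fun e => (ne_of_lt hlt) (σ.injective e)
        refine ⟨⟨by omega, by omega⟩, by omega, ?_⟩
        rcases le_total (σ q.1) (σ q.2) with h | h
        · rw [min_eq_left h, max_eq_right h]; simpa using hg
        · rw [min_eq_right h, max_eq_left h]; simp only [Equiv.symm_apply_apply]; rw [M.g_symm]; exact hg
      · rcases le_total (σ q.1) (σ q.2) with h | h
        · rw [min_eq_left h, max_eq_right h]; simp only [Equiv.symm_apply_apply]
          rw [min_eq_left hlt.le, max_eq_right hlt.le]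
        · rw [min_eq_right h, max_eq_left h]; simp only [Equiv.symm_apply_apply]
          rw [min_eq_right hlt.le, max_eq_left hlt.le]
          -- then σ q.2 ≤ σ q.1 and q.1 < q.2: the pair is (q.1, q.2) anyway
  node := by
    intro v hv
    have h := M.node (σ.symm v) ((symm_lt_iff σ hσ v).2 hv)
    rw [Finset.sum_image fun t _ t' _ e => relab_injective σ e]
    simp only [relab_symm_relab]
    exact h
  ang_nonneg := fun t v => M.ang_nonneg _ _
  ang_le_pi := fun t v => M.ang_le_pi _ _
  ang_zero := by
    intro t ht v hv
    rw [Finset.mem_image] at ht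
    obtain ⟨t₀, ht₀, rfl⟩ := ht
    rw [relab_symm_relab]
    exact M.ang_zero t₀ ht₀ _ (fun h => hv ((mem_relab_iff σ).2 h))
  cos_law := by
    intro t ht v hv a ha b hb hva hvb hab
    rw [Finset.mem_image] at ht
    obtain ⟨t₀, ht₀, rfl⟩ := ht
    rw [mem_relab_iff] at hv ha hb
    rw [relab_symm_relab]
    exact M.cos_law t₀ ht₀ _ hv _ ha _ hb (fun e => hva (σ.symm.injective e)) (fun e => hvb (σ.symm.injective e))
      (fun e => hab (σ.symm.injective e))
  circum := by
    intro t ht v hv a ha b hb hva hvb hab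
    rw [Finset.mem_image] at ht
    obtain ⟨t₀, ht₀, rfl⟩ := ht
    rw [mem_relab_iff] at hv ha hb
    exact M.circum t₀ ht₀ _ hv _ ha _ hb (fun e => hva (σ.symm.injective e)) (fun e => hvb (σ.symm.injective e))
      (fun e => hab (σ.symm.injective e))
  pairing := by
    intro p q v w hpq hvw h1 h2 g1 g2 g3 g4
    have img : ∀ {x y z : ℕ}, ({x, y, z} : Finset ℕ) ∈ M.T.image (relab σ) →
        ({σ.symm x, σ.symm y, σ.symm z} : Finset ℕ) ∈ M.T := by
      intro x y z h
      rw [Finset.mem_image] at h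
      obtain ⟨t₀, ht₀, e⟩ := h
      have : relab σ.symm (relab σ t₀) = relab σ.symm {x, y, z} := by rw [e]
      rw [relab_symm_relab] at this
      rw [this] at ht₀
      unfold relab at ht₀
      simpa [Finset.image_insert, Finset.image_singleton] using ht₀
    exact M.pairing _ _ _ _ (fun e => hpq (σ.symm.injective e)) (fun e => hvw (σ.symm.injective e)) (img h1) (img h2)
      g1 g2 g3 g4
  link := by
    intro v hv A hA hAne hcl
    -- pull back `A`
    set A₀ := A.image (relab σ.symm) with hA₀
    have hv₀ : σ.symm v < 12 := (symm_lt_iff σ hσ v).2 hv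
    have hA₀sub : A₀ ⊆ M.T.filter fun t => σ.symm v ∈ t := by
      intro t ht
      rw [hA₀, Finset.mem_image] at ht
      obtain ⟨t', ht', rfl⟩ := ht
      have := hA ht'
      rw [Finset.mem_filter, Finset.mem_image] at this
      obtain ⟨⟨t₀, ht₀, rfl⟩, hv'⟩ := this
      rw [Finset.mem_filter, relab_symm_relab]
      exact ⟨ht₀, (mem_relab_iff σ).1 hv'⟩
    have hA₀ne : A₀.Nonempty := by rw [hA₀]; exact hAne.image _
    have hcl₀ : ∀ t ∈ A₀, ∀ t' ∈ M.T, σ.symm v ∈ t' → (t ∩ t').card = 2 → t' ∈ A₀ := by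
      intro t ht t' ht' hvt' h2
      rw [hA₀, Finset.mem_image] at ht
      obtain ⟨t₁, ht₁, rfl⟩ := ht
      have h := hcl t₁ ht₁ (relab σ t') (Finset.mem_image_of_mem _ ht') ((mem_relab_iff σ).2 hvt') ?_
      · rw [hA₀, Finset.mem_image]; exact ⟨relab σ t', h, relab_symm_relab σ t'⟩
      · -- intersections correspond
        have : relab σ.symm t₁ ∩ t' = relab σ.symm (t₁ ∩ relab σ t') := by
          unfold relab
          ext x
          simp only [Finset.mem_inter, Finset.mem_image]
          constructor
          · rintro ⟨⟨y, hy, rfl⟩, hx⟩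
            exact ⟨y, ⟨hy, σ.symm y, hx, by simp⟩, rfl⟩
          · rintro ⟨y, ⟨hy, z, hz, hzy⟩, rfl⟩
            refine ⟨⟨y, hy, rfl⟩, ?_⟩
            rw [← hzy]; simpa using hz
        rw [this] at h2
        unfold relab at h2 ⊢
        rwa [Finset.card_image_of_injective _ σ.symm.injective] at h2
    have heq := M.link _ hv₀ A₀ hA₀sub hA₀ne hcl₀
    -- push forward
    ext t'
    constructor
    · exact fun h => hA h
    · intro ht'
      rw [Finset.mem_filter, Finset.mem_image] at ht'
      obtain ⟨⟨t₀, ht₀, rfl⟩, hv'⟩ := ht'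
      have : t₀ ∈ A₀ := by rw [heq, Finset.mem_filter]; exact ⟨ht₀, (mem_relab_iff σ).1 hv'⟩
      rw [hA₀, Finset.mem_image] at this
      obtain ⟨t₁, ht₁, e⟩ := this
      have : relab σ (relab σ.symm t₁) = relab σ t₀ := by rw [e]
      rw [relab_relab_symm] at this
      rw [← this]; exact ht₁
  conn := by
    intro D hD hDne hcl
    set D₀ := D.image σ.symm with hD₀
    have hD₀sub : D₀ ⊆ Finset.range 12 := by
      intro a ha
      rw [hD₀, Finset.mem_image] at ha
      obtain ⟨b, hb, rfl⟩ := ha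
      rw [Finset.mem_range, symm_lt_iff σ hσ]
      exact Finset.mem_range.1 (hD hb)
    have hD₀ne : D₀.Nonempty := by rw [hD₀]; exact hDne.image _
    have hcl₀ : ∀ t ∈ M.T, (∃ a ∈ t, a ∈ D₀) → t ⊆ D₀ := by
      intro t ht ⟨a, hat, haD⟩
      rw [hD₀, Finset.mem_image] at haD
      obtain ⟨b, hb, hba⟩ := haD
      have h := hcl (relab σ t) (Finset.mem_image_of_mem _ ht) ⟨b, (mem_relab_iff σ).2 (by rw [hba]; exact hat), hb⟩
      intro x hx
      rw [hD₀, Finset.mem_image]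
      exact ⟨σ x, h ((mem_relab_iff σ).2 (by simpa using hx)), by simp⟩
    have heq := M.conn D₀ hD₀sub hD₀ne hcl₀
    ext a
    constructor
    · exact fun h => hD h
    · intro ha
      rw [Finset.mem_range] at ha
      have : σ.symm a ∈ D₀ := by rw [heq, Finset.mem_range, symm_lt_iff σ hσ]; exact ha
      rw [hD₀, Finset.mem_image] at this
      obtain ⟨b, hb, e⟩ := this
      rw [σ.symm.injective e] at hb  -- e : σ.symm b = σ.symm a
      exact hb
  cover := by
    intro v hv
    obtain ⟨t, ht, hvt⟩ := M.cover _ ((symm_lt_iff σ hσ v).2 hv)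
    exact ⟨relab σ t, Finset.mem_image_of_mem _ ht, (mem_relab_iff σ).2 hvt⟩

end Relabel

end GSearch

end Summit.Ventures.Crystal3D.Kissing125
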